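import Summits.Ventures.WeilGRH.ReflectionInequalityBeyond
import Summits.Ventures.WeilGRH.FrontierTransfer
import Summits.Ventures.WeilGRH.DoubleReflectionTransfer
import HarnessLib

/-!
# GRH arm (rh-explicit, venture WeilGRH): the DOUBLE transfer at the `ζ` frontier (primes `2·4` and `3`)

On the frontier windows `log 2 ≤ a`, `log 3 < 2a ≤ log 5` the prime powers `n = 2, 3, 4` enter and, for a
character `χ` mod `q ≠ 1` (`FrontierTransfer.lean` bookkeeping),

`Re Q_χ(g) ≥ Re Q_ζ(g) − 2|c|² + (log q)‖g‖₂² + Σ_{n=2,3,4} 2k_n' Re[(1 − χ(n)) k(log n)]`,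

`k₂' = log 2/√2`, `k₃' = log 3/√3`, `k₄' = log 2/2`. `FrontierTransfer.lean` reflects `3` and pays `2, 4`
crudely (`q ≥ 450`). Here the pair/triple fibres of the shift `log 2` carry `2` AND `4` exactly
(`reflection_inequality_beyond`, `2a < 3 log 2`), the shift `log 3` is reflected as before
(`reflection_inequality_at`), and the two certificates are combined convexly as in
`DoubleReflectionTransfer.lean`. To keep every identity RATIONAL downstream, the weights and phases of the
`2·4` part are free parameters `κ₂ω₂ ≈ k₂'(1 − χ(2))`, `κ₄ω₄ ≈ k₄'(1 − χ(4))`: the approximation error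
`ε ≥ 2‖k₂'(1−χ(2)) − κ₂ω₂‖ + ‖k₄'(1−χ(4)) − κ₄ω₄‖` is charged to the budget through `‖k(log 2)‖ ≤ ‖g‖²`,
`2‖k(log 4)‖ ≤ ‖g‖²`. Result (**frontier double transfer**): budgets `B₂₄ + B₃ + ε ≤ B ≤ log q`, weights
`t₂₄G₂₄ ≤ 1`, `t₃G₃ ≤ 1`, `t₂₄ + t₃ ≥ 2`, and Weil positivity for `ζ` on `[-a, a]` give `WeilPositivityOnChar χ a`.
Instances (`a = 4023/5000`, `EvenWinsBeyondArch.weilPositivityOn_8046`) are in `FrontierDoubleRungs.lean`.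

## References

* A. Weil (1952), (11) and the «lemme» p. 262; H. Yoshida (1992) §6.
-/

noncomputable section

open Complex Filter Set MeasureTheory
open scoped Real Topology ComplexConjugate ArithmeticFunction.vonMangoldt

namespace Summit.Ventures.WeilGRH

open Literature.NumberTheory.LFunctions

variable {q : ℕ} {g : ℝ → ℂ}

/-- **FRONTIER DOUBLE TRANSFER** (see the module docstring; any parity, any `χ(2)`, `χ(3)`).
[cite: Weil1952FormulesExplicites, (11) and the «lemme» p. 262; Yoshida1992 §6] -/
theorem weilPositivityOnChar_transfer_frontier_double [NeZero q] {a : ℝ}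
    (ha3 : Real.log 3 < 2 * a) (ha4 : Real.log 2 ≤ a) (ha5 : 2 * a ≤ Real.log 5)
    (hζ : WeilPositivityOn a) (hq1 : q ≠ 1) (χ : DirichletCharacter ℂ q)
    {B B₂₄ B₃ ε t₂₄ t₃ κ₂ κ₄ κ₃ : ℝ} {ω₂ ω₄ : ℂ} (hω₂ : ‖ω₂‖ = 1)
    (hκ₂ : 0 ≤ κ₂) (hκB₂ : κ₂ < B₂₄)
    (hε : 2 * ‖((Real.log 2 / Real.sqrt 2 : ℝ) : ℂ) * (1 - χ (2 : ZMod q)) - κ₂ * ω₂‖ +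
      ‖((Real.log 2 / 2 : ℝ) : ℂ) * (1 - χ (4 : ZMod q)) - κ₄ * ω₄‖ ≤ ε)
    (hκ₃ : κ₃ = Real.log 3 / Real.sqrt 3 * ‖1 - χ (3 : ZMod q)‖) (hκB₃ : κ₃ < B₃)
    (hBq : B ≤ Real.log q) (hBB : B₂₄ + B₃ + ε ≤ B) (ht₂₄ : 0 ≤ t₂₄) (ht₃ : 0 ≤ t₃) (ht : 2 ≤ t₂₄ + t₃)
    -- the `LDL*` datum of the `2·4` triple form
    {d₂ d₃ : ℝ} (hd₂ : 0 < d₂) (hd₃ : 0 < d₃) {p r s : ℂ}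
    (hI : B₂₄ * ‖p‖ ^ 2 + d₂ = B₂₄) (hII : B₂₄ * ‖r‖ ^ 2 + d₂ * ‖s‖ ^ 2 + d₃ = B₂₄)
    (hIII : (B₂₄ : ℂ) * conj p = κ₂ * ω₂) (hIV : (B₂₄ : ℂ) * conj r = κ₄ * ω₄)
    (hV : (B₂₄ : ℂ) * p * conj r + d₂ * conj s = κ₂ * ω₂)
    -- window constants of the `2·4` part (`L = log 2`, `m' = 2 log 2 − a`)
    {m' CP IP J11 J22 J33 J12 J13 J23 : ℝ} (hm' : m' = 2 * Real.log 2 - a)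
    (hCP : CP = ∫ x in (a - Real.log 2)..m', Real.cosh (x / 2) ^ 2)
    (hIP : IP = ∫ x in (a - Real.log 2)..m', Real.cosh (x / 2) * Real.cosh ((Real.log 2 - x) / 2))
    (hJ11 : J11 = ∫ x in m'..a, Real.cosh (x / 2) ^ 2)
    (hJ22 : J22 = ∫ x in m'..a, Real.cosh ((x - Real.log 2) / 2) ^ 2)
    (hJ33 : J33 = ∫ x in m'..a, Real.cosh ((x - 2 * Real.log 2) / 2) ^ 2)
    (hJ12 : J12 = ∫ x in m'..a, Real.cosh (x / 2) * Real.cosh ((x - Real.log 2) / 2))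
    (hJ13 : J13 = ∫ x in m'..a, Real.cosh (x / 2) * Real.cosh ((x - 2 * Real.log 2) / 2))
    (hJ23 : J23 = ∫ x in m'..a, Real.cosh ((x - Real.log 2) / 2) * Real.cosh ((x - 2 * Real.log 2) / 2))
    (hcrit₂₄ : t₂₄ * ((CP + ω₂.re * IP) / (B₂₄ + κ₂) + (CP - ω₂.re * IP) / (B₂₄ - κ₂) +
        (J11 / B₂₄ + (J22 - 2 * p.re * J12 + ‖p‖ ^ 2 * J11) / d₂ +
          (J33 + ‖s‖ ^ 2 * J22 + ‖p * s - r‖ ^ 2 * J11 - 2 * s.re * J23 + 2 * (p * s - r).re * J13 -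
            2 * (s * conj (p * s - r)).re * J12) / d₃)) ≤ 1)
    -- window constants of the `3` part (`m₃ = log 3 − a`)
    {m₃ CM₃ CA₃ IA₃ : ℝ} (hm₃ : m₃ = Real.log 3 - a) (hCM₃ : CM₃ = Real.sinh m₃ + m₃)
    (hCA₃ : CA₃ = (Real.sinh a - Real.sinh m₃ + (a - m₃)) / 2)
    (hIA₃ : IA₃ = (a - m₃) * Real.cosh (Real.log 3 / 2) / 2 + Real.sinh (a - Real.log 3 / 2))
    (hcrit₃ : t₃ * (CM₃ * (B₃ ^ 2 - κ₃ ^ 2) +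
        2 * B₃ * (B₃ * CA₃ - Real.log 3 / Real.sqrt 3 * (1 - χ (3 : ZMod q)).re * IA₃)) ≤
      B₃ * (B₃ ^ 2 - κ₃ ^ 2)) :
    WeilPositivityOnChar χ a := by
  intro g hg hsupp
  set L := Real.log 2 with hL
  set L₃ := Real.log 3 with hL₃
  set k₂ : ℝ := Real.log 2 / Real.sqrt 2 with hk₂
  set k₃ : ℝ := Real.log 3 / Real.sqrt 3 with hk₃
  set k₄ : ℝ := Real.log 2 / 2 with hk₄
  set u₂ : ℂ := 1 - χ (2 : ZMod q) with hu₂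
  set u₃ : ℂ := 1 - χ (3 : ZMod q) with hu₃
  set u₄ : ℂ := 1 - χ (4 : ZMod q) with hu₄
  have hk₃0 : 0 < k₃ := div_pos (Real.log_pos (by norm_num)) (by positivity)
  have hκ₃0 : 0 ≤ κ₃ := by rw [hκ₃]; exact mul_nonneg hk₃0.le (norm_nonneg _)
  have hL0 : 0 < L := Real.log_pos (by norm_num)
  have hlog23 : Real.log 2 < Real.log 3 := Real.log_lt_log (by norm_num) (by norm_num)
  have ha9 : a ≤ Real.log 3 := by
    have h59 : Real.log 5 ≤ 2 * Real.log 3 := by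
      rw [← Real.log_rpow (by norm_num), show ((3 : ℝ) ^ (2 : ℝ)) = 9 by norm_num]
      exact Real.log_le_log (by norm_num) (by norm_num)
    linarith
  have h3L : 2 * a < 3 * L := by
    have h58 : Real.log 5 < 3 * Real.log 2 := by
      rw [← Real.log_rpow (by norm_num), show ((2 : ℝ) ^ (3 : ℝ)) = 8 by norm_num]
      exact Real.log_lt_log (by norm_num) (by norm_num)
    linarith
  have hlog4 : Real.log 4 = 2 * Real.log 2 := by
    rw [← Real.log_rpow (by norm_num), show ((2 : ℝ) ^ (2 : ℝ)) = 4 by norm_num]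
  -- the phase of `u₃`
  obtain ⟨ω₃, hω₃, huω₃⟩ := exists_norm_mul_phase u₃
  have hωre₃ : ‖u₃‖ * ω₃.re = u₃.re := by
    conv_rhs => rw [huω₃]
    rw [Complex.re_ofReal_mul]
  set kL₂ := weilConv g (weilReflect g) L with hkL₂
  set kL₃ := weilConv g (weilReflect g) L₃ with hkL₃
  set kL₄ := weilConv g (weilReflect g) (2 * L) with hkL₄
  set N : ℝ := ∫ x, ‖g x‖ ^ 2 with hN
  set c : ℂ := ∫ x, g x * (Real.cosh (x / 2) : ℂ) with hc
  -- the two inequalities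
  obtain ⟨hW₂₄0, hineq₂₄⟩ := reflection_inequality_beyond hg hsupp hL0 ha4 h3L hω₂ hκ₂ hκB₂ hd₂ hd₃ hI hII
    hIII hIV hV hm' hCP hIP hJ11 hJ22 hJ33 hJ12 hJ13 hJ23 (κ' := κ₄) (ω' := ω₄)
  obtain ⟨hW₃0, hineq₃⟩ := reflection_inequality_at hg hsupp ha3 ha9 hω₃ hκ₃0 hκB₃ hm₃ hCM₃ hCA₃ hIA₃
  set W₂₄ : ℝ := B₂₄ * N + 2 * κ₂ * (ω₂ * kL₂).re + 2 * κ₄ * (ω₄ * kL₄).re with hW₂₄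
  set W₃ : ℝ := B₃ * N + 2 * κ₃ * (ω₃ * kL₃).re with hW₃
  set G₂₄ : ℝ := (CP + ω₂.re * IP) / (B₂₄ + κ₂) + (CP - ω₂.re * IP) / (B₂₄ - κ₂) +
    (J11 / B₂₄ + (J22 - 2 * p.re * J12 + ‖p‖ ^ 2 * J11) / d₂ +
      (J33 + ‖s‖ ^ 2 * J22 + ‖p * s - r‖ ^ 2 * J11 - 2 * s.re * J23 + 2 * (p * s - r).re * J13 -
        2 * (s * conj (p * s - r)).re * J12) / d₃) with hG₂₄
  set G₃ : ℝ := CM₃ / B₃ + (CA₃ + ω₃.re * IA₃) / (B₃ + κ₃) + (CA₃ - ω₃.re * IA₃) / (B₃ - κ₃) with hG₃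
  have hκre₃ : κ₃ * ω₃.re = k₃ * u₃.re := by
    rw [hκ₃, ← hωre₃, hk₃]; ring
  have htG₃ : t₃ * G₃ ≤ 1 := by
    refine mul_G_le_one_of_cleared hκ₃0 hκB₃ ?_
    rw [hκre₃]; exact hcrit₃
  -- convex combination
  have hc₂₄ : t₂₄ * ‖c‖ ^ 2 ≤ W₂₄ := by
    have h1 : ‖c‖ ^ 2 ≤ W₂₄ * G₂₄ := hineq₂₄
    have h2 : t₂₄ * ‖c‖ ^ 2 ≤ t₂₄ * (W₂₄ * G₂₄) := mul_le_mul_of_nonneg_left h1 ht₂₄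
    have h3 : t₂₄ * (W₂₄ * G₂₄) = W₂₄ * (t₂₄ * G₂₄) := by ring
    have h4 : W₂₄ * (t₂₄ * G₂₄) ≤ W₂₄ * 1 := mul_le_mul_of_nonneg_left hcrit₂₄ hW₂₄0
    linarith
  have hc₃ : t₃ * ‖c‖ ^ 2 ≤ W₃ := by
    have h1 : ‖c‖ ^ 2 ≤ W₃ * G₃ := hineq₃
    have h2 : t₃ * ‖c‖ ^ 2 ≤ t₃ * (W₃ * G₃) := mul_le_mul_of_nonneg_left h1 ht₃
    have h3 : t₃ * (W₃ * G₃) = W₃ * (t₃ * G₃) := by ring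
    have h4 : W₃ * (t₃ * G₃) ≤ W₃ * 1 := mul_le_mul_of_nonneg_left htG₃ hW₃0
    linarith
  have hc2 : 2 * ‖c‖ ^ 2 ≤ W₂₄ + W₃ := by
    have h0 : 0 ≤ ‖c‖ ^ 2 := by positivity
    have h5 : 2 * ‖c‖ ^ 2 ≤ (t₂₄ + t₃) * ‖c‖ ^ 2 := mul_le_mul_of_nonneg_right ht h0
    rw [add_mul] at h5
    linarith only [h5, hc₂₄, hc₃]
  -- the corrections
  have hk : tsupport (weilConv g (weilReflect g)) ⊆ Icc (-Real.log 5) (Real.log 5) :=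
    (tsupport_weilConv_weilReflect_subset hg.2 hsupp).trans (Icc_subset_Icc (by linarith) ha5)
  have hD := re_weilPrimeTerm_sub_weilPrimeTermChar_three χ hg hk
  rw [hlog4] at hD
  have hDW₃ : 2 * κ₃ * (ω₃ * kL₃).re = 2 * k₃ * (u₃ * kL₃).re := by
    rw [huω₃, mul_assoc (‖u₃‖ : ℂ), Complex.re_ofReal_mul, hκ₃, hk₃]
    ring
  -- the approximation slack of the `2·4` part
  have hN0 : 0 ≤ N := integral_nonneg fun t ↦ by positivity
  have hk2N : ‖kL₂‖ ≤ N := norm_weilConv_weilReflect_le hg _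
  have hk4N : 2 * ‖kL₄‖ ≤ N := by
    refine two_mul_norm_weilConv_weilReflect_le hg hsupp ?_ ?_
    · have h516 : Real.log 5 < Real.log 16 := Real.log_lt_log (by norm_num) (by norm_num)
      rw [show (16 : ℝ) = 2 ^ 4 by norm_num, Real.log_pow] at h516
      push_cast at h516
      linarith
    · linarith
  have hslack : -(ε * N) ≤ (2 * k₂ * (u₂ * kL₂).re + 2 * k₄ * (u₄ * kL₄).re) -
      (2 * κ₂ * (ω₂ * kL₂).re + 2 * κ₄ * (ω₄ * kL₄).re) := by
    set δ₂ : ℂ := (k₂ : ℂ) * u₂ - κ₂ * ω₂ with hδ₂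
    set δ₄ : ℂ := (k₄ : ℂ) * u₄ - κ₄ * ω₄ with hδ₄
    have e2 : 2 * k₂ * (u₂ * kL₂).re - 2 * κ₂ * (ω₂ * kL₂).re = 2 * (δ₂ * kL₂).re := by
      have : δ₂ * kL₂ = (k₂ : ℂ) * (u₂ * kL₂) - (κ₂ : ℂ) * (ω₂ * kL₂) := by rw [hδ₂]; ring
      rw [this, Complex.sub_re, Complex.re_ofReal_mul, Complex.re_ofReal_mul]; ring
    have e4 : 2 * k₄ * (u₄ * kL₄).re - 2 * κ₄ * (ω₄ * kL₄).re = 2 * (δ₄ * kL₄).re := by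
      have : δ₄ * kL₄ = (k₄ : ℂ) * (u₄ * kL₄) - (κ₄ : ℂ) * (ω₄ * kL₄) := by rw [hδ₄]; ring
      rw [this, Complex.sub_re, Complex.re_ofReal_mul, Complex.re_ofReal_mul]; ring
    have b2 : |(δ₂ * kL₂).re| ≤ ‖δ₂‖ * ‖kL₂‖ := by rw [← norm_mul]; exact Complex.abs_re_le_norm _
    have b4 : |(δ₄ * kL₄).re| ≤ ‖δ₄‖ * ‖kL₄‖ := by rw [← norm_mul]; exact Complex.abs_re_le_norm _
    have c2 : ‖δ₂‖ * ‖kL₂‖ ≤ ‖δ₂‖ * N := mul_le_mul_of_nonneg_left hk2N (norm_nonneg _)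
    have c4 : 2 * (‖δ₄‖ * ‖kL₄‖) ≤ ‖δ₄‖ * N := by
      calc 2 * (‖δ₄‖ * ‖kL₄‖) = ‖δ₄‖ * (2 * ‖kL₄‖) := by ring
        _ ≤ ‖δ₄‖ * N := mul_le_mul_of_nonneg_left hk4N (norm_nonneg _)
    have hε' : 2 * (‖δ₂‖ * N) + ‖δ₄‖ * N ≤ ε * N := by
      calc 2 * (‖δ₂‖ * N) + ‖δ₄‖ * N = (2 * ‖δ₂‖ + ‖δ₄‖) * N := by ring
        _ ≤ ε * N := mul_le_mul_of_nonneg_right hε hN0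
    have l2 := (abs_le.1 b2).1
    have l4 := (abs_le.1 b4).1
    linarith only [l2, l4, c2, c4, hε', e2, e4]
  have hmain := re_weilQuadraticChar_ge hq1 χ hg
  have hζg : 0 ≤ (weilQuadratic g).re := hζ g hg hsupp
  have hP := two_mul_re_weilMellin_le hg
  have hNB : B * N ≤ N * Real.log q := by
    have h := mul_le_mul_of_nonneg_left hBq hN0
    rwa [mul_comm N B] at h
  have hBN : (B₂₄ + B₃ + ε) * N ≤ B * N := mul_le_mul_of_nonneg_right hBB hN0
  rw [hD] at hmain
  rw [hW₂₄, hW₃, hDW₃] at hc2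
  simp only [hkL₂, hkL₃, hkL₄, hu₂, hu₃, hu₄, hk₂, hk₃, hk₄, hL, hL₃, hN, hc] at hc2 hslack hNB hBN hmain hP
  linarith

end Summit.Ventures.WeilGRH
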